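import Summits.NavierStokesRegularity.FunctionalMining.ConvexMollifier
import Mathlib.Analysis.SpecialFunctions.Pow.Deriv
import Mathlib.Analysis.Convex.SpecificFunctions.Basic
import Mathlib.MeasureTheory.Measure.Haar.InnerProductSpace
import HarnessLib

/-!
# FunctionalMining — the regularised power weight `W_φ = (φ̃ ⋆ g + 2r)^q` of a convex Lipschitz `g`

Search for candidate a priori estimates; no regularity claim. Cell `pub-nsfunc`, prove seat
(gen 16). The weight that replaces a non-smooth convex density `S ↦ g(S)^q` in a balance law —
used with `g = λ₁` (top Rayleigh value `TopEig.lam`, K0 rows `ES.lam1.q|T_C|C1`) and with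
`g = λ₁ ∘ (−·) = −λ₃` (rows `ES.neglam3.q|T_C|C1`). For `g : ℝ^ι → ℝ` convex and `1`-Lipschitz and
a normed bump `φ` of outer radius `r`:

`g̃_φ := φ̃ ⋆ g + 2r`   (`TopEig.lamReg`; smooth, convex, `1`-Lipschitz, `g + r ≤ g̃_φ ≤ g + 3r`),
`W_φ := g̃_φ^q` on the open set `U_φ = {g̃_φ > 0} ⊇ {g ≥ 0}`   (`TopEig.weight`),

with `W_φ` smooth on `U_φ`, `‖DW_φ(z)‖ ≤ q g̃_φ(z)^{q−1}`, `D²W_φ(z)[w,w] ≥ 0` (`q ≥ 1`; local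
convexity of `t ↦ g̃_φ(z+tw)^q` and `ConvexMollifier.hessian_quadratic_nonneg`), and the sandwich
`g^q ≤ W_φ ≤ (g + 3r)^q` where `g ≥ 0`. [ours]
-/

noncomputable section

open MeasureTheory Set Filter Topology Metric
open scoped ContDiff NNReal

namespace Summit.NavierStokesRegularity.FunctionalMining

namespace TopEig

variable {ι : Type*} [Fintype ι]

/-! ## 1. The regularised density -/

/-- `g̃_φ = φ̃ ⋆ g + 2 r_out`. [ours] -/
def lamReg (φ : ContDiffBump (0 : EuclideanSpace ℝ ι)) (g : EuclideanSpace ℝ ι → ℝ)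
    (z : EuclideanSpace ℝ ι) : ℝ :=
  ConvexMollifier.mollify volume φ g z + 2 * φ.rOut

variable (φ : ContDiffBump (0 : EuclideanSpace ℝ ι)) {g : EuclideanSpace ℝ ι → ℝ}

/-- `g̃_φ` is smooth (for continuous `g`). [ours] -/
theorem contDiff_lamReg (hgc : Continuous g) : ContDiff ℝ ∞ (lamReg φ g) :=
  (ConvexMollifier.contDiff_mollify volume φ hgc).add contDiff_const

/-- `g̃_φ` is convex (for convex continuous `g`). [ours] -/
theorem convexOn_lamReg (hconv : ConvexOn ℝ univ g) (hgc : Continuous g) :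
    ConvexOn ℝ univ (lamReg φ g) :=
  (ConvexMollifier.convexOn_mollify volume φ hconv hgc).add (convexOn_const _ convex_univ)

/-- `g̃_φ` is `1`-Lipschitz (for `1`-Lipschitz `g`). [ours] -/
theorem lipschitzWith_lamReg (hlip : LipschitzWith 1 g) : LipschitzWith 1 (lamReg φ g) := by
  refine LipschitzWith.of_dist_le_mul fun x y => ?_
  have h := (ConvexMollifier.lipschitzWith_mollify volume φ hlip).dist_le_mul x y
  have e : dist (lamReg φ g x) (lamReg φ g y) =
      dist (ConvexMollifier.mollify volume φ g x) (ConvexMollifier.mollify volume φ g y) := by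
    simp only [lamReg, Real.dist_eq, add_sub_add_right_eq_sub]
  rw [e]
  exact h

/-- `‖Dg̃_φ‖ ≤ 1`. [ours] -/
theorem norm_fderiv_lamReg_le (hlip : LipschitzWith 1 g) (z : EuclideanSpace ℝ ι) :
    ‖fderiv ℝ (lamReg φ g) z‖ ≤ 1 := by
  have h := norm_fderiv_le_of_lipschitz ℝ (x₀ := z) (lipschitzWith_lamReg φ hlip)
  simpa using h

/-- The sandwich `g + r ≤ g̃_φ ≤ g + 3r`. [ours] -/
theorem lamReg_mem_Icc (hlip : LipschitzWith 1 g) (z : EuclideanSpace ℝ ι) :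
    g z + φ.rOut ≤ lamReg φ g z ∧ lamReg φ g z ≤ g z + 3 * φ.rOut := by
  have h := ConvexMollifier.mollify_mem_Icc volume φ hlip z
  simp only [NNReal.coe_one, one_mul] at h
  unfold lamReg
  constructor <;> linarith [h.1, h.2]

/-! ## 2. The weight `W_φ = g̃_φ^q` on `U_φ = {g̃_φ > 0}` -/

/-- The set `U_φ = {g̃_φ > 0}`. [ours] -/
def posSet (g : EuclideanSpace ℝ ι → ℝ) : Set (EuclideanSpace ℝ ι) := {z | 0 < lamReg φ g z}

/-- `U_φ` is open. [ours] -/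
theorem isOpen_posSet (hgc : Continuous g) : IsOpen (posSet φ g) :=
  isOpen_lt continuous_const (contDiff_lamReg φ hgc).continuous

/-- Points with `g ≥ 0` lie in `U_φ`, with `g̃_φ ≥ r_out` there. [ours] -/
theorem mem_posSet_of_nonneg (hlip : LipschitzWith 1 g) {z : EuclideanSpace ℝ ι} (hz : 0 ≤ g z) :
    z ∈ posSet φ g ∧ φ.rOut ≤ lamReg φ g z := by
  have h := (lamReg_mem_Icc φ hlip z).1
  exact ⟨show 0 < lamReg φ g z by linarith [φ.rOut_pos], by linarith⟩

/-- The weight `W_φ(z) = g̃_φ(z)^q` (real power). [ours] -/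
def weight (g : EuclideanSpace ℝ ι → ℝ) (q : ℝ) (z : EuclideanSpace ℝ ι) : ℝ := lamReg φ g z ^ q

/-- `W_φ` is smooth on `U_φ`. [ours] -/
theorem contDiffOn_weight (hgc : Continuous g) (q : ℝ) {n : WithTop ℕ∞} (hn : n ≤ ∞) :
    ContDiffOn ℝ n (weight φ g q) (posSet φ g) :=
  ((contDiff_lamReg φ hgc).of_le hn).contDiffOn.rpow_const_of_ne fun _ hz => ne_of_gt hz

/-- The derivative of `W_φ` on `U_φ`: `DW_φ(z) = q g̃_φ(z)^{q−1} Dg̃_φ(z)`. [ours] -/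
theorem hasFDerivAt_weight (hgc : Continuous g) (q : ℝ) {z : EuclideanSpace ℝ ι}
    (hz : z ∈ posSet φ g) :
    HasFDerivAt (weight φ g q) ((q * lamReg φ g z ^ (q - 1)) • fderiv ℝ (lamReg φ g) z) z :=
  (((contDiff_lamReg φ hgc).differentiable (by simp)).differentiableAt.hasFDerivAt).rpow_const
    (Or.inl (ne_of_gt hz))

/-- **`‖DW_φ(z)‖ ≤ q g̃_φ(z)^{q−1}`** on `U_φ` (`q ≥ 0`). [ours] -/
theorem norm_fderiv_weight_le (hlip : LipschitzWith 1 g) {q : ℝ} (hq : 0 ≤ q)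
    {z : EuclideanSpace ℝ ι} (hz : z ∈ posSet φ g) :
    ‖fderiv ℝ (weight φ g q) z‖ ≤ q * lamReg φ g z ^ (q - 1) := by
  rw [(hasFDerivAt_weight φ hlip.continuous q hz).fderiv, norm_smul, Real.norm_eq_abs,
    abs_of_nonneg (mul_nonneg hq (Real.rpow_nonneg (le_of_lt hz) _))]
  calc q * lamReg φ g z ^ (q - 1) * ‖fderiv ℝ (lamReg φ g) z‖
      ≤ q * lamReg φ g z ^ (q - 1) * 1 :=
        mul_le_mul_of_nonneg_left (norm_fderiv_lamReg_le φ hlip z)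
          (mul_nonneg hq (Real.rpow_nonneg (le_of_lt hz) _))
    _ = q * lamReg φ g z ^ (q - 1) := mul_one _

/-- `|DW_φ(z)[w]| ≤ q g̃_φ(z)^{q−1} ‖w‖` on `U_φ`. [ours] -/
theorem abs_fderiv_weight_apply_le (hlip : LipschitzWith 1 g) {q : ℝ} (hq : 0 ≤ q)
    {z : EuclideanSpace ℝ ι} (hz : z ∈ posSet φ g) (w : EuclideanSpace ℝ ι) :
    |fderiv ℝ (weight φ g q) z w| ≤ q * lamReg φ g z ^ (q - 1) * ‖w‖ := by
  rw [← Real.norm_eq_abs]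
  exact ((fderiv ℝ (weight φ g q) z).le_opNorm w).trans
    (mul_le_mul_of_nonneg_right (norm_fderiv_weight_le φ hlip hq hz) (norm_nonneg _))

/-- **Local convexity along lines**: for `z ∈ U_φ` and any direction `w` there is `r > 0` with
`z + t w ∈ U_φ` for `|t| < r` and `t ↦ W_φ(z + t w)` convex on `(−r, r)` (`q ≥ 1`). [ours] -/
theorem exists_convexOn_weight_line (hconv : ConvexOn ℝ univ g) (hlip : LipschitzWith 1 g)
    {q : ℝ} (hq : 1 ≤ q) {z : EuclideanSpace ℝ ι} (hz : z ∈ posSet φ g) (w : EuclideanSpace ℝ ι) :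
    ∃ r : ℝ, 0 < r ∧ (∀ t ∈ Ioo (-r) r, z + t • w ∈ posSet φ g) ∧
      ConvexOn ℝ (Ioo (-r) r) (fun t : ℝ => weight φ g q (z + t • w)) := by
  have hgc : Continuous g := hlip.continuous
  obtain ⟨δ, hδ, hball⟩ := Metric.isOpen_iff.1 (isOpen_posSet φ hgc) z hz
  set r : ℝ := δ / (‖w‖ + 1) with hr
  have hw1 : 0 < ‖w‖ + 1 := by positivity
  have hr0 : 0 < r := div_pos hδ hw1
  have hmem : ∀ t ∈ Ioo (-r) r, z + t • w ∈ posSet φ g := by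
    intro t ht
    apply hball
    rw [mem_ball, dist_eq_norm, add_sub_cancel_left, norm_smul, Real.norm_eq_abs]
    have ht' : |t| < r := abs_lt.2 ht
    calc |t| * ‖w‖ ≤ r * ‖w‖ := mul_le_mul_of_nonneg_right ht'.le (norm_nonneg _)
      _ < δ := by
          rw [hr, div_mul_eq_mul_div, div_lt_iff₀ hw1]
          nlinarith [norm_nonneg w]
  refine ⟨r, hr0, hmem, ⟨convex_Ioo _ _, fun s hs t ht a b ha hb hab => ?_⟩⟩
  have hst : a • s + b • t ∈ Ioo (-r) r := (convex_Ioo (-r) r) hs ht ha hb hab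
  simp only [smul_eq_mul] at hst ⊢
  have hX : 0 < lamReg φ g (z + s • w) := hmem s hs
  have hY : 0 < lamReg φ g (z + t • w) := hmem t ht
  have h0 : 0 < lamReg φ g (z + (a * s + b * t) • w) := hmem _ hst
  have hlin : a • (z + s • w) + b • (z + t • w) = z + (a * s + b * t) • w := by
    calc a • (z + s • w) + b • (z + t • w) = (a + b) • z + (a * s + b * t) • w := by
          simp only [smul_add, smul_smul, add_smul]; abel
      _ = z + (a * s + b * t) • w := by rw [hab, one_smul]
  have h1 : lamReg φ g (z + (a * s + b * t) • w) ≤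
      a * lamReg φ g (z + s • w) + b * lamReg φ g (z + t • w) := by
    have h := (convexOn_lamReg φ hconv hgc).2 (mem_univ (z + s • w)) (mem_univ (z + t • w)) ha hb hab
    rw [hlin] at h
    simpa only [smul_eq_mul] using h
  have hq0 : 0 ≤ q := by linarith
  have h2 := (convexOn_rpow hq).2 (mem_Ici.2 hX.le) (mem_Ici.2 hY.le) ha hb hab
  simp only [smul_eq_mul] at h2
  unfold weight
  calc lamReg φ g (z + (a * s + b * t) • w) ^ q
      ≤ (a * lamReg φ g (z + s • w) + b * lamReg φ g (z + t • w)) ^ q :=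
        Real.rpow_le_rpow h0.le h1 hq0
    _ ≤ a * lamReg φ g (z + s • w) ^ q + b * lamReg φ g (z + t • w) ^ q := h2

/-- **`D²W_φ(z)[w, w] ≥ 0`** on `U_φ` for `q ≥ 1`. [ours] -/
theorem hessian_weight_nonneg (hconv : ConvexOn ℝ univ g) (hlip : LipschitzWith 1 g)
    {q : ℝ} (hq : 1 ≤ q) {z : EuclideanSpace ℝ ι} (hz : z ∈ posSet φ g) (w : EuclideanSpace ℝ ι) :
    0 ≤ (fderiv ℝ (fderiv ℝ (weight φ g q)) z w) w := by
  obtain ⟨r, hr, hmem, hcv⟩ := exists_convexOn_weight_line φ hconv hlip hq hz w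
  refine ConvexMollifier.hessian_quadratic_nonneg hr hcv fun t ht => ?_
  exact (contDiffOn_weight φ hlip.continuous q (n := 2) (by norm_cast)).contDiffAt
    ((isOpen_posSet φ hlip.continuous).mem_nhds (hmem t ht))

/-- The sandwich `g^q ≤ W_φ ≤ (g + 3r)^q` where `g ≥ 0` (`q ≥ 0`). [ours] -/
theorem weight_mem_Icc (hlip : LipschitzWith 1 g) {q : ℝ} (hq : 0 ≤ q) {z : EuclideanSpace ℝ ι}
    (hz : 0 ≤ g z) :
    g z ^ q ≤ weight φ g q z ∧ weight φ g q z ≤ (g z + 3 * φ.rOut) ^ q := by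
  obtain ⟨h1, h2⟩ := lamReg_mem_Icc φ hlip z
  have hr := φ.rOut_pos
  exact ⟨Real.rpow_le_rpow hz (by linarith) hq, Real.rpow_le_rpow (by linarith) h2 hq⟩

/-- `W_φ ≥ 0` on `U_φ`. [ours] -/
theorem weight_nonneg (q : ℝ) {z : EuclideanSpace ℝ ι} (hz : z ∈ posSet φ g) :
    0 ≤ weight φ g q z :=
  Real.rpow_nonneg (le_of_lt hz) _

/-- `g ≤ g̃_φ`, hence any bound `‖z‖ ≤ c g(z)` passes to `g̃_φ` (`c ≥ 0`). [ours] -/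
theorem le_mul_lamReg_of_le_mul (hlip : LipschitzWith 1 g) {c : ℝ} (hc : 0 ≤ c)
    {z : EuclideanSpace ℝ ι} {a : ℝ} (h : a ≤ c * g z) : a ≤ c * lamReg φ g z :=
  h.trans (mul_le_mul_of_nonneg_left (by linarith [(lamReg_mem_Icc φ hlip z).1, φ.rOut_pos]) hc)

end TopEig

end Summit.NavierStokesRegularity.FunctionalMining

end
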